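import Literature.Computability.Cryptography.LWEPrimePowerGF2Solve
import Literature.Computability.Cryptography.LWEPrimePowerTopSpec
import HarnessLib

/-!
# The top solver of the machine: Hensel lifting over `ℤ_{2ᵉ}` with `GF(2)` solves (MP12 Thm. 3.1, the machine's Gaussian elimination, II)

Topic `Computability/Cryptography` (LWE), grouping namespace `LWE.MP12`, sequel of
`LWEPrimePowerGF2Solve.lean` (`gf2Solve`: a full-column-rank system over `GF(2)` solved by kernel
tests) and `LWEPrimePowerTopSpec.lean` (`IsTopSolverFR`). Proved material (no named fact) towards
`Literature.Computability.Cryptography.blprs_gapSVP_sqrt_dim_to_lwe_classical` (**pqc.S21**),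
component Thm. 2.17 = Micciancio–Peikert 2012, Thm. 3.1, p. 16 ("solve for `s` by Gaussian
elimination"), for BLPRS's modulus `Q = 2ᵉ`.

The top system of the reduction is `2ᵃ·⟨aₖ, t⟩ = rₖ` in `ℤ_{2ᵉ}` (`k < m'`). The solver `topSolve`:
check that every `rₖ` is divisible by `2ᵃ` (else output `0`); with `r'ₖ = rₖ/2ᵃ` and `K = 2^{e-a}`,
build `t = ∑_{j<e-a} 2ʲ tⱼ` digit by digit — at digit `j`, from the accumulated `t_acc` (`< 2ʲ`), the
residual `((r'ₖ - ⟨aₖ, t_acc⟩) mod K)/2ʲ mod 2` is the right-hand side of a `GF(2)` system with the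
matrix `(aₖ mod 2)ₖ`, solved by `gf2Solve` — and output `2ᵃ·t`. When the matrix has full column rank
mod `2` and the system has a solution `t⋆`, every digit system is solvable (by the digits of
`t⋆ mod K`) and uniquely so, hence `t = t⋆ mod K` and the output is `2ᵃ·t⋆`
(**`isTopSolverFR_topSolve`**). Everything is elementary arithmetic in `ℕ`; the polynomial-time
realisation on codes is the sequel.

## References

* D. Micciancio, C. Peikert, *Trapdoors for lattices: simpler, tighter, faster, smaller*, EUROCRYPT 2012,
  LNCS 7237; full version IACR ePrint 2011/501, §3, proof of Thm. 3.1, p. 16. [MicciancioPeikert2012]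
* J. von zur Gathen, J. Gerhard, *Modern Computer Algebra*, 3rd ed., CUP 2013, §15.4 (linear Hensel /
  `p`-adic lifting). (Schoolbook; everything is proved here.)
-/

noncomputable section

namespace Literature.Computability.Cryptography

namespace LWE

namespace MP12

open Finset Literature.Computability.Complexity.BLR

section Lift

variable {m' d e : ℕ}

/-- The entries of the coefficient matrix as natural numbers (representatives in `[0, 2ᵉ)`). [folklore] -/
def Aval (S : Fin m' → (Fin d → ZMod (2 ^ e)) × ZMod (2 ^ e)) (i : Fin m') (c : Fin d) : ℕ := ((S i).1 c).val

/-- The coefficient matrix mod `2`, as bits. [folklore] -/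
def Abit (S : Fin m' → (Fin d → ZMod (2 ^ e)) × ZMod (2 ^ e)) : Fin m' → Fin d → Bool :=
  fun i c => decide (Aval S i c % 2 = 1)

/-- **The residual bit of row `i` at digit `j`**: `((r'ᵢ - ⟨aᵢ, t_acc⟩) mod K)/2ʲ mod 2`, computed in `ℕ`.
[cite: MicciancioPeikert2012, Thm. 3.1 proof (p. 16)] -/
def resid (S : Fin m' → (Fin d → ZMod (2 ^ e)) × ZMod (2 ^ e)) (r' : Fin m' → ℕ) (K j : ℕ) (tacc : Fin d → ℕ)
    (i : Fin m') : Bool :=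
  decide (((r' i % K + K - (∑ c, Aval S i c * tacc c) % K) % K / 2 ^ j) % 2 = 1)

/-- **One lifting step**: add `2ʲ` times the `GF(2)` solution of the residual system. [cite: MicciancioPeikert2012, Thm. 3.1 proof (p. 16)] -/
def liftStep (S : Fin m' → (Fin d → ZMod (2 ^ e)) × ZMod (2 ^ e)) (r' : Fin m' → ℕ) (K j : ℕ) (tacc : Fin d → ℕ) :
    Fin d → ℕ :=
  fun c => tacc c + 2 ^ j * (if gf2Solve (Abit S) (resid S r' K j tacc) c then 1 else 0)

/-- **The first `j` digits.** [cite: MicciancioPeikert2012, Thm. 3.1 proof (p. 16)] -/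
def liftUpTo (S : Fin m' → (Fin d → ZMod (2 ^ e)) × ZMod (2 ^ e)) (r' : Fin m' → ℕ) (K : ℕ) : ℕ → Fin d → ℕ
  | 0 => fun _ => 0
  | j + 1 => liftStep S r' K j (liftUpTo S r' K j)

open Classical in
/-- **The top solver**: divisibility check, `e - a` lifting steps, output `2ᵃ·t`. [cite: MicciancioPeikert2012, Thm. 3.1 proof (p. 16: "solve for `s` by Gaussian elimination")] -/
def topSolve (e a : ℕ) (S : Fin m' → (Fin d → ZMod (2 ^ e)) × ZMod (2 ^ e)) (r : Fin m' → ZMod (2 ^ e)) :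
    Fin d → ZMod (2 ^ e) :=
  if ∀ i, 2 ^ a ∣ (r i).val then
    fun c => ((2 ^ a * liftUpTo S (fun i => (r i).val / 2 ^ a) (2 ^ (e - a)) (e - a) c : ℕ) : ZMod (2 ^ e))
  else 0

/-! ### Correctness -/

/-- The parity bit of a number, as an element of `ZMod 2`, is the number. [folklore] -/
theorem toZ_decide_mod_two (n : ℕ) : toZ (decide (n % 2 = 1)) = (n : ZMod 2) := by
  rw [← ZMod.natCast_mod n 2]
  rcases Nat.mod_two_eq_zero_or_one n with h | h <;> simp [h, Literature.Computability.Complexity.BLR.toZ]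

/-- The bit matrix of `Abit` is the reduction mod `2` of the coefficient matrix. [folklore] -/
theorem matZ_Abit (he : 0 < e) (S : Fin m' → (Fin d → ZMod (2 ^ e)) × ZMod (2 ^ e)) :
    matZ (Abit S) = fun k i => ZMod.castHom (dvd_pow_self 2 he.ne') (ZMod 2) ((S k).1 i) := by
  funext k i
  rw [matZ, Abit, ZMod.castHom_apply, ZMod.cast_eq_val, Aval]
  exact toZ_decide_mod_two _

/-- `(2ʲ·D) mod (2ʲ·L) / 2ʲ mod 2 = D mod 2` for `2 ∣ L`. [folklore] -/
theorem mul_mod_mul_div_mod_two {j L D : ℕ} (hL : 2 ∣ L) :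
    (2 ^ j * D) % (2 ^ j * L) / 2 ^ j % 2 = D % 2 := by
  rw [Nat.mul_mod_mul_left, Nat.mul_div_cancel_left _ (Nat.two_pow_pos j)]
  exact Nat.mod_mod_of_dvd _ hL

/-- `τ mod 2^{j+1} = τ mod 2ʲ + 2ʲ·((τ / 2ʲ) mod 2)`. [folklore] -/
theorem mod_pow_succ_eq (τ j : ℕ) : τ % 2 ^ (j + 1) = τ % 2 ^ j + 2 ^ j * (τ / 2 ^ j % 2) := by
  have h1 : τ = (τ % 2 ^ j + 2 ^ j * (τ / 2 ^ j % 2)) + (2 ^ j * 2) * (τ / 2 ^ j / 2) := by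
    have e1 := Nat.div_add_mod τ (2 ^ j)
    have e2 := Nat.div_add_mod (τ / 2 ^ j) 2
    calc τ = 2 ^ j * (τ / 2 ^ j) + τ % 2 ^ j := e1.symm
      _ = 2 ^ j * (2 * (τ / 2 ^ j / 2) + τ / 2 ^ j % 2) + τ % 2 ^ j := by rw [e2]
      _ = _ := by ring
  have hlt : τ % 2 ^ j + 2 ^ j * (τ / 2 ^ j % 2) < 2 ^ j * 2 := by
    have h2 := Nat.mod_lt τ (Nat.two_pow_pos j)
    have h3 : 2 ^ j * (τ / 2 ^ j % 2) ≤ 2 ^ j * 1 := Nat.mul_le_mul_left _ (by omega)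
    set B := 2 ^ j * (τ / 2 ^ j % 2)
    omega
  conv_lhs => rw [pow_succ, h1]
  rw [Nat.add_mul_mod_self_left, Nat.mod_eq_of_lt hlt]

/-- **The lifting invariant.** If `∑_c aᵢc·τ_c ≡ r'ᵢ (mod 2ᵏ)` for all rows and the bit matrix has full
column rank, then after `j ≤ k` steps the accumulator is `τ mod 2ʲ`.
[cite: MicciancioPeikert2012, Thm. 3.1 proof (p. 16)] -/
theorem liftUpTo_eq {S : Fin m' → (Fin d → ZMod (2 ^ e)) × ZMod (2 ^ e)} (hA : FullRank (matZ (Abit S)))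
    {r' : Fin m' → ℕ} {k : ℕ} {τ : Fin d → ℕ}
    (hτ : ∀ i, (∑ c, Aval S i c * τ c) % 2 ^ k = r' i % 2 ^ k) :
    ∀ {j : ℕ}, j ≤ k → liftUpTo S r' (2 ^ k) j = fun c => τ c % 2 ^ j
  | 0, _ => by funext c; simp [liftUpTo, Nat.mod_one]
  | j + 1, hj => by
    have hjk : j < k := hj
    have ih := liftUpTo_eq hA hτ hjk.le
    rw [liftUpTo, ih]
    -- the residual system is solved by the `j`-th digits of `τ`
    set δ : Fin d → ℕ := fun c => τ c / 2 ^ j with hδ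
    have hsplit : ∀ c, τ c = 2 ^ j * δ c + τ c % 2 ^ j := fun c => (Nat.div_add_mod (τ c) (2 ^ j)).symm
    have hK : 2 ^ k = 2 ^ j * 2 ^ (k - j) := by rw [← pow_add, Nat.add_sub_cancel' hjk.le]
    have hL2 : 2 ∣ 2 ^ (k - j) := dvd_pow_self 2 (by omega)
    have hres : ∀ i, resid S r' (2 ^ k) j (fun c => τ c % 2 ^ j) i = decide ((∑ c, Aval S i c * δ c) % 2 = 1) := by
      intro i
      unfold resid
      congr 2
      set T : ℕ := ∑ c, Aval S i c * (τ c % 2 ^ j) with hT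
      set D : ℕ := ∑ c, Aval S i c * δ c with hD
      have hsum : ∑ c, Aval S i c * τ c = 2 ^ j * D + T := by
        rw [hD, hT, Finset.mul_sum, ← Finset.sum_add_distrib]
        refine Finset.sum_congr rfl fun c _ => ?_
        conv_lhs => rw [hsplit c]
        ring
      -- `z ≡ r' - T ≡ 2ʲ D (mod 2ᵏ)` and `z < 2ᵏ`, so `z = (2ʲ D) mod 2ᵏ`
      have hKpos : 0 < 2 ^ k := Nat.two_pow_pos k
      have hz : (r' i % 2 ^ k + 2 ^ k - T % 2 ^ k) % 2 ^ k = (2 ^ j * D) % 2 ^ k := by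
        have h1 : r' i % 2 ^ k = (2 ^ j * D + T) % 2 ^ k := by rw [← hsum, hτ i]
        rw [h1, Nat.add_mod (2 ^ j * D) T]
        set K := 2 ^ k with hKdef
        set μ := (2 ^ j * D) % K with hμ
        set l := T % K with hl
        have hTlt : l < K := Nat.mod_lt _ hKpos
        have hDlt : μ < K := Nat.mod_lt _ hKpos
        have hμK : μ % K = μ := Nat.mod_eq_of_lt hDlt
        rcases Nat.lt_or_ge (μ + l) K with hc | hc
        · rw [Nat.mod_eq_of_lt hc, show μ + l + K - l = μ + K by omega, Nat.add_mod_right, hμK]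
        · have hml : (μ + l) % K = μ + l - K := by
            rw [Nat.mod_eq_sub_mod hc, Nat.mod_eq_of_lt (by omega)]
          rw [hml, show μ + l - K + K - l = μ by omega, hμK]
      rw [hz, hK, mul_mod_mul_div_mod_two hL2]
    -- so `gf2Solve` returns the digits `δ mod 2`
    have hsol : gf2Solve (Abit S) (resid S r' (2 ^ k) j fun c => τ c % 2 ^ j) = fun c => decide (δ c % 2 = 1) := by
      refine gf2Solve_eq hA fun i => ?_
      rw [hres i, toZ_decide_mod_two, Nat.cast_sum]
      refine Finset.sum_congr rfl fun c _ => ?_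
      rw [Abit, toZ_decide_mod_two, toZ_decide_mod_two, Nat.cast_mul, Aval]
    funext c
    rw [liftStep, hsol, mod_pow_succ_eq]
    show τ c % 2 ^ j + 2 ^ j * (if decide (δ c % 2 = 1) then 1 else 0) = τ c % 2 ^ j + 2 ^ j * (δ c % 2)
    congr 2
    by_cases hodd : δ c % 2 = 1
    · rw [if_pos (decide_eq_true hodd), hodd]
    · have hev : δ c % 2 = 0 := by omega
      rw [if_neg (by simp [hev]), hev]

/-- `(2 : ZMod 2ᵉ)ᵃ = 0` for `a ≥ e`. [folklore] -/
theorem two_pow_eq_zero_of_le {a : ℕ} (hae : e ≤ a) : ((2 : ℕ) : ZMod (2 ^ e)) ^ a = 0 := by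
  have : ((2 : ℕ) : ZMod (2 ^ e)) ^ e = 0 := by rw [← Nat.cast_pow]; exact ZMod.natCast_self (2 ^ e)
  rw [show a = e + (a - e) by omega, pow_add, this, zero_mul]

/-- **The top solver meets the restricted specification**, for every exponent `a`.
[cite: MicciancioPeikert2012, Thm. 3.1 proof (p. 16)] -/
theorem isTopSolverFR_topSolve (he : 0 < e) (a : ℕ) :
    IsTopSolverFR (p := 2) a he (topSolve (m' := m') (d := d) e a) := by
  intro S r hFR hex
  obtain ⟨ts, hts⟩ := hex
  refine ⟨ts, hts, ?_⟩
  set P : ℕ := 2 ^ a with hP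
  have hP0 : 0 < P := Nat.two_pow_pos a
  -- (1) every `rᵢ` is divisible by `2ᵃ`
  have hval : ∀ i, (r i).val = (P * ((S i).1 ⬝ᵥ ts).val) % 2 ^ e := by
    intro i
    rw [← hts i, ZMod.val_mul, ← Nat.cast_pow, ZMod.val_natCast, Nat.mod_mul_mod]
  have hdiv : ∀ i, 2 ^ a ∣ (r i).val := by
    intro i
    rcases le_or_gt a e with hae | hae
    · rw [hval i]
      exact (Nat.dvd_mod_iff (pow_dvd_pow 2 hae)).2 (dvd_mul_right _ _)
    · have : r i = 0 := by rw [← hts i, two_pow_eq_zero_of_le hae.le, zero_mul]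
      rw [this, ZMod.val_zero]
      exact dvd_zero _
  unfold topSolve
  rw [if_pos hdiv]
  rcases le_or_gt a e with hae | hae
  · -- (2) the key congruence `∑ aᵢc τ_c ≡ r'ᵢ (mod 2ᵏ)` with `τ = ts.val mod 2ᵏ`
    set k := e - a with hk
    have hek : e = a + k := by omega
    have hQeq : 2 ^ e = P * 2 ^ k := by rw [hP, ← pow_add, ← hek]
    set τ : Fin d → ℕ := fun c => (ts c).val % 2 ^ k with hτ
    have hτlt : ∀ c, τ c < 2 ^ k := fun c => Nat.mod_lt _ (Nat.two_pow_pos k)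
    have hkey : ∀ i, (∑ c, Aval S i c * τ c) % 2 ^ k = ((r i).val / 2 ^ a) % 2 ^ k := by
      intro i
      set X : ℕ := ∑ c, Aval S i c * (ts c).val with hX
      have hdot : ((S i).1 ⬝ᵥ ts).val = X % 2 ^ e := by
        have h : ((S i).1 ⬝ᵥ ts) = ((X : ℕ) : ZMod (2 ^ e)) := by
          rw [hX, Nat.cast_sum, dotProduct]
          refine Finset.sum_congr rfl fun c _ => ?_
          rw [Nat.cast_mul, Aval, ZMod.natCast_zmod_val, ZMod.natCast_zmod_val]
        rw [h, ZMod.val_natCast]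
      obtain ⟨r', hr'⟩ := hdiv i
      rw [← hP] at hr'
      -- `P·r' ≡ P·X (mod P·2ᵏ)`, cancel `P`
      have h1 : (P * r') % (P * 2 ^ k) = (P * X) % (P * 2 ^ k) := by
        calc (P * r') % (P * 2 ^ k) = (r i).val % 2 ^ e := by rw [← hQeq, ← hr']
          _ = (P * (X % 2 ^ e)) % 2 ^ e := by rw [hval i, hdot, Nat.mod_mod]
          _ = (P * X) % 2 ^ e := by rw [Nat.mul_mod, Nat.mod_mod, ← Nat.mul_mod]
          _ = (P * X) % (P * 2 ^ k) := by rw [hQeq]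
      rw [Nat.mul_mod_mul_left, Nat.mul_mod_mul_left] at h1
      have h2 : r' % 2 ^ k = X % 2 ^ k := Nat.eq_of_mul_eq_mul_left hP0 h1
      rw [hr', Nat.mul_div_cancel_left _ hP0, h2, hX, Finset.sum_nat_mod, Finset.sum_congr rfl fun c _ => ?_,
        ← Finset.sum_nat_mod]
      rw [hτ]
      simp only
      rw [Nat.mul_mod, Nat.mod_mod, ← Nat.mul_mod]
    have hA : FullRank (matZ (Abit S)) := by rw [matZ_Abit he]; exact hFR
    have hlift := liftUpTo_eq (S := S) hA (r' := fun i => (r i).val / 2 ^ a) (k := k) (τ := τ) hkey le_rfl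
    rw [hlift]
    funext c
    simp only [Pi.smul_apply, smul_eq_mul]
    rw [Nat.mod_eq_of_lt (hτlt c), hτ]
    -- `2ᵃ·(v mod 2ᵏ) ≡ 2ᵃ·v (mod 2ᵉ)`
    have hmod : 2 ^ a * ((ts c).val % 2 ^ k) ≡ 2 ^ a * (ts c).val [MOD 2 ^ e] := by
      have h := (Nat.mod_modEq ((ts c).val) (2 ^ k)).mul_left' (2 ^ a)
      rwa [← pow_add, ← hek] at h
    have hcast : ((2 ^ a * ((ts c).val % 2 ^ k) : ℕ) : ZMod (2 ^ e)) = ((2 ^ a * (ts c).val : ℕ) : ZMod (2 ^ e)) :=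
      (ZMod.natCast_eq_natCast_iff _ _ _).2 hmod
    simp only
    rw [hcast, Nat.cast_mul, Nat.cast_pow, ZMod.natCast_zmod_val]
  · -- `a > e`: `2ᵃ = 0`, everything is `0`
    have h0 := two_pow_eq_zero_of_le (e := e) hae.le
    funext c
    simp only [Pi.smul_apply, smul_eq_mul]
    rw [h0, zero_mul, Nat.cast_mul, Nat.cast_pow, h0, zero_mul]

end Lift

end MP12

end LWE

end Literature.Computability.Cryptography

end
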